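import Literature.IUT.HodgeArakelov.ThetaEvaluationSetting
import Mathlib.Combinatorics.SimpleGraph.DegreeSum
import Mathlib.Data.Set.Card

/-!
# [IUTchII] Rmk 2.1.1 (ii): the dual-graph uniqueness claims — PROOF companion (`Rmk211_ii_uniqueness`)

Proof-only companion to the landed `ThetaEvaluationSetting.lean` (p407103; frozen, not edited). S. Mochizuki,
*Inter-universal Teichmüller theory II*, kurims manuscript (Dec. 2020), Remark 2.1.1 (ii) p. 65: "`Γ▶_X ⊆ Γ_X`
[is] the unique connected subgraph of `Γ_X` which is a tree that is stabilized by `ι_X` and contains every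
vertex of `Γ_X`; `Γ•_X ⊆ Γ▶_X` [is] the unique connected subgraph of `Γ_X` stabilized by `ι_X` that contains
precisely one vertex and no edges". The landed file types this as the named `Prop` `Rmk211_ii_uniqueness l`
over the Mathlib models `loopGraph l` (the `l`-cycle `Γ_X` on the labels `ℤ/lℤ`), `triGraph l` (`Γ▶_X`, the
cycle with the edge `{l⋇, -l⋇}` deleted), `labelNeg`/`bulletVerts` (`ι_X`, `Γ•_X`), and left it undischarged
("graph-theoretic; not discharged here"); abc-iut-L6-t20's note L6t1-N1 observed that the `def` carries no
parity binder. DISCHARGED HERE under the binders of the text (`l` odd, `l ≥ 3` — in [IUTchI] Def. 3.1 `l ≥ 5`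
is an odd prime): `Rmk211_ii_uniqueness_of_odd`. Route: the `l`-cycle has `l` edges (handshake, all degrees
`2`), `Γ▶_X` has `l - 1` edges and is connected (explicit paths `0, 1, …, j` and their `ι_X`-images), hence is
a tree (`SimpleGraph.isTree_iff_connected_and_card`); a spanning tree of the cycle omits exactly one edge,
and `ι_X`-stability forces that edge to be the `ι_X`-fixed edge `{l⋇, l⋇+1} = {l⋇, -l⋇}`.
Claim key `Mochizuki2012`, status DISPUTED (D-0012): the remark is expository graph combinatorics; nothing
here bears on [IUTchIII] Cor. 3.12.
-/

namespace Literature.IUT.HodgeArakelov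

open Literature.IUT.HodgeTheaters SimpleGraph

variable (l : ℕ)

/-! ## Arithmetic of the labels `ℤ/lℤ`, `l = 2l⋇ + 1` -/

/-- `2·l⋇ + 1 = l` for odd `l`. [cite: Mochizuki2012, Rmk 2.1.1 (ii) p.65] -/
theorem two_mul_lStar_add_one (hl : Odd l) : 2 * lStar l + 1 = l := by
  obtain ⟨m, rfl⟩ := hl
  simp only [lStar]
  omega

/-- In `ℤ/lℤ` (odd `l`): `l⋇ + l⋇ + 1 = 0`. [cite: Mochizuki2012, Rmk 2.1.1 (ii) p.65] -/
theorem lStar_add_lStar_add_one (hl : Odd l) : (lStar l : ZMod l) + lStar l + 1 = 0 := by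
  have h := congrArg (fun n : ℕ => (n : ZMod l)) (two_mul_lStar_add_one l hl)
  simp only [Nat.cast_add, Nat.cast_mul, Nat.cast_ofNat, Nat.cast_one, ZMod.natCast_self] at h
  rw [← h]
  ring

/-- In `ℤ/lℤ` (odd `l`): `-l⋇ = l⋇ + 1`. [cite: Mochizuki2012, Rmk 2.1.1 (ii) p.65] -/
theorem neg_lStar_eq (hl : Odd l) : -(lStar l : ZMod l) = lStar l + 1 := by
  rw [neg_eq_iff_add_eq_zero]
  have := lStar_add_lStar_add_one l hl
  rw [← this]
  ring

/-- `1 ≠ 0` in `ℤ/lℤ` for `l ≥ 2`. [cite: Mochizuki2012, Rmk 2.1.1 (ii) p.65] -/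
theorem one_ne_zero_of_two_le (h2 : 2 ≤ l) : (1 : ZMod l) ≠ 0 := by
  intro h
  rw [← Nat.cast_one, ZMod.natCast_eq_zero_iff, Nat.dvd_one] at h
  omega

/-- `2 ≠ 0` in `ℤ/lℤ` for `l ≥ 3`. [cite: Mochizuki2012, Rmk 2.1.1 (ii) p.65] -/
theorem two_ne_zero_of_three_le (h3 : 3 ≤ l) : (2 : ZMod l) ≠ 0 := by
  intro h
  rw [← Nat.cast_ofNat, ZMod.natCast_eq_zero_iff] at h
  have := Nat.le_of_dvd (by norm_num) h
  omega

/-- For odd `l`, doubling is injective on `ℤ/lℤ`. [cite: Mochizuki2012, Rmk 2.1.1 (ii) p.65] -/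
theorem eq_of_add_self_eq (hl : Odd l) {a b : ZMod l} (h : a + a = b + b) : a = b := by
  have h' : (a - b) + (a - b) = 0 := by
    calc (a - b) + (a - b) = (a + a) - (b + b) := by ring
      _ = 0 := by rw [h, sub_self]
  rwa [ZMod.add_self_eq_zero_iff_eq_zero hl, sub_eq_zero] at h'

/-! ## The cycle `Γ_X = loopGraph l` -/

/-- Adjacency in the `l`-cycle: labels differing by `±1`. [cite: Mochizuki2012, Rmk 2.1.1 (ii) p.65] -/
theorem loopGraph_adj {a b : ZMod l} : (loopGraph l).Adj a b ↔ a ≠ b ∧ (a - b = 1 ∨ b - a = 1) := by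
  simp only [loopGraph, SimpleGraph.circulantGraph_adj, Set.mem_singleton_iff]

/-- For `l ≥ 2`: `b` is adjacent to `a` iff `b = a + 1` or `b = a - 1`. [cite: Mochizuki2012, Rmk 2.1.1 (ii) p.65] -/
theorem loopGraph_adj_iff (h2 : 2 ≤ l) {a b : ZMod l} :
    (loopGraph l).Adj a b ↔ b = a + 1 ∨ b = a - 1 := by
  rw [loopGraph_adj]
  constructor
  · rintro ⟨-, h | h⟩
    · right
      rw [← h]
      ring
    · left
      rw [← h]
      ring
  · rintro (rfl | rfl)
    · refine ⟨fun h => one_ne_zero_of_two_le l h2 ?_, Or.inr (by ring)⟩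
      calc (1 : ZMod l) = (a + 1) - a := by ring
        _ = 0 := by rw [← h, sub_self]
    · refine ⟨fun h => one_ne_zero_of_two_le l h2 ?_, Or.inl (by ring)⟩
      calc (1 : ZMod l) = a - (a - 1) := by ring
        _ = 0 := by rw [← h, sub_self]

/-- `ι_X` (negation of labels) is an automorphism of the cycle. [cite: Mochizuki2012, Rmk 2.1.1 (ii) p.65] -/
theorem loopGraph_adj_neg (a b : ZMod l) : (loopGraph l).Adj (-a) (-b) ↔ (loopGraph l).Adj a b := by
  simp only [loopGraph_adj, neg_sub_neg, ne_eq, neg_inj]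
  exact ⟨fun ⟨h1, h2⟩ => ⟨h1, h2.symm⟩, fun ⟨h1, h2⟩ => ⟨h1, h2.symm⟩⟩

/-- The deleted edge `{l⋇, -l⋇}` IS an edge of the cycle (odd `l ≥ 3`). [cite: Mochizuki2012, Rmk 2.1.1 (ii) p.65] -/
theorem lStar_edge_mem (hl : Odd l) (h3 : 3 ≤ l) :
    s((lStar l : ZMod l), -(lStar l : ZMod l)) ∈ (loopGraph l).edgeSet := by
  rw [SimpleGraph.mem_edgeSet, loopGraph_adj_iff l (by omega), neg_lStar_eq l hl]
  exact Or.inl rfl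

/-- Every label has exactly the two neighbours `a ± 1` (odd `l ≥ 3`), so the cycle has `l` edges.
[cite: Mochizuki2012, Rmk 2.1.1 (ii) p.65] -/
theorem loopGraph_edgeSet_ncard (h3 : 3 ≤ l) : (loopGraph l).edgeSet.ncard = l := by
  classical
  haveI : NeZero l := ⟨by omega⟩
  have hdeg : ∀ v : ZMod l, (loopGraph l).degree v = 2 := by
    intro v
    have hnb : (loopGraph l).neighborFinset v = {v + 1, v - 1} := by
      ext w
      rw [SimpleGraph.mem_neighborFinset, loopGraph_adj_iff l (by omega), Finset.mem_insert,
        Finset.mem_singleton]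
    have hne : v + 1 ≠ v - 1 := by
      intro h
      apply two_ne_zero_of_three_le l h3
      calc (2 : ZMod l) = (v + 1) - (v - 1) := by ring
        _ = 0 := by rw [h, sub_self]
    rw [← SimpleGraph.card_neighborFinset_eq_degree, hnb, Finset.card_pair hne]
  have hsum := SimpleGraph.sum_degrees_eq_twice_card_edges (loopGraph l)
  simp only [hdeg, Finset.sum_const, Finset.card_univ, ZMod.card, smul_eq_mul] at hsum
  rw [← SimpleGraph.coe_edgeFinset, Set.ncard_coe_finset]
  omega

/-! ## `Γ▶_X = triGraph l`: a tree -/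

/-- `Γ▶_X` has `l - 1` edges (odd `l ≥ 3`). [cite: Mochizuki2012, Rmk 2.1.1 (ii) p.65] -/
theorem triGraph_edgeSet_ncard (hl : Odd l) (h3 : 3 ≤ l) : (triGraph l).edgeSet.ncard = l - 1 := by
  rw [triGraph, SimpleGraph.edgeSet_deleteEdges, Set.ncard_sdiff_singleton_of_mem (lStar_edge_mem l hl h3),
    loopGraph_edgeSet_ncard l h3]

/-- The labels `0, 1, …, l⋇` are reachable from `0` inside `Γ▶_X` (the deleted edge `{l⋇, l⋇+1}` is never
used). [cite: Mochizuki2012, Rmk 2.1.1 (ii) p.65] -/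
theorem triGraph_reachable_natCast (hl : Odd l) (h3 : 3 ≤ l) :
    ∀ n : ℕ, n ≤ lStar l → (triGraph l).Reachable 0 (n : ZMod l) := by
  have hL := two_mul_lStar_add_one l hl
  intro n
  induction n with
  | zero => intro; simp
  | succ n ih =>
    intro hn
    refine (ih (by omega)).trans (SimpleGraph.Adj.reachable ?_)
    rw [triGraph, SimpleGraph.deleteEdges_adj, Set.mem_singleton_iff, loopGraph_adj_iff l (by omega)]
    refine ⟨Or.inl (by push_cast; ring), ?_⟩
    rw [neg_lStar_eq l hl, Sym2.eq_iff]
    push_cast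
    rintro (⟨h1, -⟩ | ⟨h1, -⟩)
    · -- `n = l⋇` in `ℤ/lℤ` with `n < l⋇ < l`
      have := (ZMod.natCast_eq_natCast_iff' n (lStar l) l).mp h1
      rw [Nat.mod_eq_of_lt (by omega), Nat.mod_eq_of_lt (by omega)] at this
      omega
    · -- `n = l⋇ + 1` in `ℤ/lℤ` with `n < l⋇ + 1 < l`
      have h1' : ((n : ℕ) : ZMod l) = ((lStar l + 1 : ℕ) : ZMod l) := by push_cast; exact h1
      have := (ZMod.natCast_eq_natCast_iff' n (lStar l + 1) l).mp h1'
      rw [Nat.mod_eq_of_lt (by omega), Nat.mod_eq_of_lt (by omega)] at this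
      omega

/-- `Γ▶_X` is connected (odd `l ≥ 3`): every label is `±n` with `n ≤ l⋇`. [cite: Mochizuki2012, Rmk 2.1.1 (ii) p.65] -/
theorem triGraph_connected (hl : Odd l) (h3 : 3 ≤ l) : (triGraph l).Connected := by
  haveI : NeZero l := ⟨by omega⟩
  have hL := two_mul_lStar_add_one l hl
  rw [SimpleGraph.connected_iff_exists_forall_reachable]
  refine ⟨0, fun v => ?_⟩
  have hv : ((v.valMinAbs : ℤ) : ZMod l) = v := ZMod.coe_valMinAbs v
  have hbound := ZMod.natAbs_valMinAbs_le v
  have hhalf : l / 2 = lStar l := by simp only [lStar]; omega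
  rcases le_or_gt 0 v.valMinAbs with h0 | h0
  · -- `v = n` with `0 ≤ n ≤ l⋇`
    have hn : ((v.valMinAbs.toNat : ℕ) : ZMod l) = v := by
      have h1 : ((v.valMinAbs.toNat : ℕ) : ℤ) = v.valMinAbs := Int.toNat_of_nonneg h0
      calc ((v.valMinAbs.toNat : ℕ) : ZMod l) = ((v.valMinAbs.toNat : ℤ) : ZMod l) :=
            (Int.cast_natCast _).symm
        _ = (v.valMinAbs : ZMod l) := by rw [h1]
        _ = v := hv
    have h := triGraph_reachable_natCast l hl h3 v.valMinAbs.toNat (by omega)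
    rwa [hn] at h
  · -- `v = -n` with `0 < n ≤ l⋇`: apply `ι_X` to the path `0 … n`
    have hn : -(((-v.valMinAbs).toNat : ℕ) : ZMod l) = v := by
      have h1 : (((-v.valMinAbs).toNat : ℕ) : ℤ) = -v.valMinAbs := Int.toNat_of_nonneg (by omega)
      calc -(((-v.valMinAbs).toNat : ℕ) : ZMod l) = -((((-v.valMinAbs).toNat : ℕ) : ℤ) : ZMod l) := by
            rw [Int.cast_natCast]
        _ = -((-v.valMinAbs : ℤ) : ZMod l) := by rw [h1]
        _ = (v.valMinAbs : ZMod l) := by rw [Int.cast_neg, neg_neg]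
        _ = v := hv
    -- `ι_X` as a graph endomorphism of `Γ▶_X` (from the landed `triGraph_adj_neg`)
    let ι : triGraph l →g triGraph l := ⟨fun a => -a, fun {a b} h => (triGraph_adj_neg l a b).mpr h⟩
    have h := (triGraph_reachable_natCast l hl h3 (-v.valMinAbs).toNat (by omega)).map ι
    change (triGraph l).Reachable (-0) (-(((-v.valMinAbs).toNat : ℕ) : ZMod l)) at h
    rwa [neg_zero, hn] at h

/-- **IUTchII:Rmk2.1.1(ii)**, first claim DISCHARGED: `Γ▶_X` "is a tree" (odd `l ≥ 3`).
[cite: Mochizuki2012, Rmk 2.1.1 (ii) p.65] -/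
theorem triGraph_isTree (hl : Odd l) (h3 : 3 ≤ l) : (triGraph l).IsTree := by
  haveI : NeZero l := ⟨by omega⟩
  rw [SimpleGraph.isTree_iff_connected_and_card]
  refine ⟨triGraph_connected l hl h3, ?_⟩
  rw [Nat.card_coe_set_eq, triGraph_edgeSet_ncard l hl h3, Nat.card_eq_fintype_card, ZMod.card]
  omega

/-! ## Uniqueness: an `ι_X`-stable spanning tree of the cycle is `Γ▶_X` -/

/-- A spanning tree of the `l`-cycle is the cycle with exactly one edge deleted (odd `l ≥ 3`).
[cite: Mochizuki2012, Rmk 2.1.1 (ii) p.65] -/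
theorem eq_deleteEdges_of_isTree_le (h3 : 3 ≤ l) {H : SimpleGraph (ZMod l)}
    (hle : H ≤ loopGraph l) (hT : H.IsTree) :
    ∃ e ∈ (loopGraph l).edgeSet, e ∉ H.edgeSet ∧ H = (loopGraph l).deleteEdges {e} := by
  haveI : NeZero l := ⟨by omega⟩
  have hsub : H.edgeSet ⊆ (loopGraph l).edgeSet := SimpleGraph.edgeSet_subset_edgeSet.mpr hle
  have hcardH : H.edgeSet.ncard = l - 1 := by
    have h := (SimpleGraph.isTree_iff_connected_and_card.mp hT).2
    rw [Nat.card_coe_set_eq, Nat.card_eq_fintype_card, ZMod.card] at h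
    omega
  have hdiff : ((loopGraph l).edgeSet \ H.edgeSet).ncard = 1 := by
    rw [Set.ncard_sdiff hsub, loopGraph_edgeSet_ncard l h3, hcardH]
    omega
  obtain ⟨e, he⟩ := Set.ncard_eq_one.mp hdiff
  have he' : e ∈ (loopGraph l).edgeSet \ H.edgeSet := by rw [he]; exact Set.mem_singleton e
  refine ⟨e, he'.1, he'.2, ?_⟩
  rw [← SimpleGraph.edgeSet_inj, SimpleGraph.edgeSet_deleteEdges]
  ext x
  constructor
  · intro hx
    refine ⟨hsub hx, ?_⟩
    rintro rfl
    exact he'.2 hx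
  · rintro ⟨hx, hxe⟩
    by_contra hxH
    have : x ∈ (loopGraph l).edgeSet \ H.edgeSet := ⟨hx, hxH⟩
    rw [he] at this
    exact hxe this

/-- `ι_X ∘ ι_X = id` on edges (`ι_X` on edges = `Sym2.map Neg.neg`). [cite: Mochizuki2012, Rmk 2.1.1 (ii) p.65] -/
theorem edgeNeg_edgeNeg (e : Sym2 (ZMod l)) : Sym2.map Neg.neg (Sym2.map Neg.neg e) = e := by
  induction e using Sym2.ind with
  | h a b => simp [Sym2.map_mk]

/-- The cycle is `ι_X`-stable on edges. [cite: Mochizuki2012, Rmk 2.1.1 (ii) p.65] -/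
theorem edgeNeg_mem_loopGraph {e : Sym2 (ZMod l)} (he : e ∈ (loopGraph l).edgeSet) :
    Sym2.map Neg.neg e ∈ (loopGraph l).edgeSet := by
  induction e using Sym2.ind with
  | h a b =>
    rw [Sym2.map_mk, SimpleGraph.mem_edgeSet, loopGraph_adj_neg]
    exact he

/-- A graph stable under the relabelling `ι_X` (as `H.map ι_X = H`) has `ι_X`-stable edge set.
[cite: Mochizuki2012, Rmk 2.1.1 (ii) p.65] -/
theorem edgeNeg_mem_of_map_neg_eq {H : SimpleGraph (ZMod l)}
    (hneg : H.map (Equiv.neg (ZMod l)).toEmbedding = H) {e : Sym2 (ZMod l)} (he : e ∈ H.edgeSet) :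
    Sym2.map Neg.neg e ∈ H.edgeSet := by
  induction e using Sym2.ind with
  | h a b =>
    rw [Sym2.map_mk, SimpleGraph.mem_edgeSet, ← hneg, SimpleGraph.map_adj]
    exact ⟨a, b, he, rfl, rfl⟩

/-- The only `ι_X`-fixed edge of the cycle is `{l⋇, -l⋇}` (odd `l ≥ 3`). [cite: Mochizuki2012, Rmk 2.1.1 (ii) p.65] -/
theorem edgeNeg_eq_self_iff (hl : Odd l) {e : Sym2 (ZMod l)} (he : e ∈ (loopGraph l).edgeSet)
    (hfix : Sym2.map Neg.neg e = e) : e = s((lStar l : ZMod l), -(lStar l : ZMod l)) := by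
  induction e using Sym2.ind with
  | h a b =>
    rw [Sym2.map_mk, Sym2.eq_iff] at hfix
    rw [SimpleGraph.mem_edgeSet] at he
    have hk := lStar_add_lStar_add_one l hl
    rcases hfix with ⟨ha, hb⟩ | ⟨hab, -⟩
    · -- both endpoints `ι_X`-fixed ⇒ both `0` ⇒ not an edge
      exfalso
      have ha0 : a = 0 := by
        have h2 : a + a = 0 := by nth_rewrite 1 [← ha]; exact neg_add_cancel a
        exact (ZMod.add_self_eq_zero_iff_eq_zero hl).mp h2
      have hb0 : b = 0 := by
        have h2 : b + b = 0 := by nth_rewrite 1 [← hb]; exact neg_add_cancel b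
        exact (ZMod.add_self_eq_zero_iff_eq_zero hl).mp h2
      exact he.ne (ha0.trans hb0.symm)
    · -- `b = -a`: the edge `{a, -a}` with `a - (-a) = ±1` ⇒ `a = ∓l⋇`
      subst hab
      rcases ((loopGraph_adj l).mp he).2 with h | h
      · -- `a + a = 1 = (l⋇+1) + (l⋇+1)` ⇒ `a = l⋇ + 1 = -l⋇`
        have haa : a + a = (lStar l + 1 : ZMod l) + (lStar l + 1) := by
          rw [sub_neg_eq_add] at h
          rw [h]
          calc (1 : ZMod l) = ((lStar l : ZMod l) + lStar l + 1) + 1 := by rw [hk, zero_add]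
            _ = _ := by ring
        have := eq_of_add_self_eq l hl haa
        rw [this, ← neg_lStar_eq l hl, neg_neg, Sym2.eq_swap]
      · -- `-(a + a) = 1` ⇒ `a + a = -1 = l⋇ + l⋇` ⇒ `a = l⋇`
        have haa : a + a = (lStar l : ZMod l) + lStar l := by
          have h' : a + a = -1 := by
            rw [eq_neg_iff_add_eq_zero, ← h]
            ring
          rw [h']
          calc (-1 : ZMod l) = ((lStar l : ZMod l) + lStar l + 1) - 1 - 0 := by rw [hk]; ring
            _ = _ := by ring
        have := eq_of_add_self_eq l hl haa
        rw [this]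

/-- **IUTchII:Rmk2.1.1(ii)**, uniqueness DISCHARGED: an `ι_X`-stable subgraph of `Γ_X` which is a tree on all
the vertices is `Γ▶_X` (odd `l ≥ 3`). [cite: Mochizuki2012, Rmk 2.1.1 (ii) p.65] -/
theorem eq_triGraph_of_isTree_of_neg_stable (hl : Odd l) (h3 : 3 ≤ l) {H : SimpleGraph (ZMod l)}
    (hle : H ≤ loopGraph l) (hT : H.IsTree) (hneg : H.map (Equiv.neg (ZMod l)).toEmbedding = H) :
    H = triGraph l := by
  obtain ⟨e, he, heH, rfl⟩ := eq_deleteEdges_of_isTree_le l h3 hle hT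
  -- the deleted edge is `ι_X`-fixed: its `ι_X`-image is a cycle edge missing from `H`
  have hfix : Sym2.map Neg.neg e = e := by
    have h1 : Sym2.map Neg.neg e ∈ (loopGraph l).edgeSet := edgeNeg_mem_loopGraph l he
    by_contra hne
    have h2 : Sym2.map Neg.neg e ∈ ((loopGraph l).deleteEdges {e}).edgeSet := by
      rw [SimpleGraph.edgeSet_deleteEdges]
      exact ⟨h1, hne⟩
    have h3' := edgeNeg_mem_of_map_neg_eq l hneg h2
    rw [edgeNeg_edgeNeg, SimpleGraph.edgeSet_deleteEdges] at h3'
    exact h3'.2 (Set.mem_singleton e)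
  rw [edgeNeg_eq_self_iff l hl he hfix]
  rfl

/-! ## The named fact -/

/-- **IUTchII:Rmk2.1.1(ii)** (kurims p. 65) — the named `Prop` `Rmk211_ii_uniqueness l` of the landed
`ThetaEvaluationSetting.lean`, DISCHARGED for odd `l ≥ 3` (the binders of the text: `l` is the odd prime of
the initial Θ-data): `Γ▶_X` is a tree, is `ι_X`-stable, is the unique `ι_X`-stable spanning tree of `Γ_X`,
and `0` is the unique `ι_X`-fixed label. [cite: Mochizuki2012, Rmk 2.1.1 (ii) p.65] -/
theorem Rmk211_ii_uniqueness_of_odd (hl : Odd l) (h3 : 3 ≤ l) : Rmk211_ii_uniqueness l := by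
  haveI : NeZero l := ⟨by omega⟩
  refine ⟨triGraph_isTree l hl h3, triGraph_map_neg l, ?_, fun j => labelNeg_eq_self_iff l hl j⟩
  intro H hle hT hneg
  exact eq_triGraph_of_isTree_of_neg_stable l hl h3 hle hT hneg

end Literature.IUT.HodgeArakelov
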